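import Literature.Geometry.Lorentzian.LocalConstraintDeformationReassembly
import Literature.Geometry.Lorentzian.LocalConstraintDeformationProofs
import HarnessLib

/-!
# `ChruscielDelay_localConstraintDeformation` from its two coordinate cores

Topic `Literature/Geometry/Lorentzian`. Everything here is PROVED; no definition, no statement of
`Prop` type is introduced (the two cores below are HYPOTHESES of the reduction theorem, spelled
out in place; they are not vendored as named facts).

`LocalConstraintDeformationProofs.lean` reduces the named fact
`ChruscielDelay_localConstraintDeformation` (`LocalConstraintDeformation.lean`) to the local
`C^∞` deformation statement `(H)`; `DataFamilyTangentKernel*.lean`,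
`LocalConstraintDeformationChart.lean` and `LocalConstraintDeformationReassembly.lean` carry
`(H)` into and out of the chart `c = chartAt E3 x₀`. What is left are two statements about
COORDINATE fields, the analytic content of the printed proof, and this file proves

  `(M) ∧ (A) ⟹ ChruscielDelay_localConstraintDeformation`
  (`ChruscielDelay_localConstraintDeformation_of_coordCore`), where

* `(M)` (Moncrief 1975; Chruściel–Delay 2004, §2 — "no local space-time Killing fields ⇒ no
  KIDs"): under the hypotheses of the fact (vacuum data `D` with vacuum Cauchy development `𝒟`,
  no nontrivial Killing field of the development near `x₀` restricting to the data), the readings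
  `(G, K) = (coordHOn, coordKOn)` of `Φ^* D` on the chart target have NO smooth coordinate KIDs
  on the small coordinate balls `ball (c x₀) ρ`, `0 < ρ ≤ ρ₀` — no smooth `(N, Y)` on the ball
  solving the symmetrised KID equations `DH*_γ N + DM*ˢ_γ Y = 0 = DH*_κ N + DM*ˢ_κ Y`
  (`MetricCoord.adjHamG`, `adjMomGS`, `adjHamK`, `adjMomKS` of `CoordConstraintAdjoint.lean`)
  other than `(0, 0)`;
* `(A)` (Chruściel–Delay 2003, Thm. 5.9 with Prop. 5.10 and Cor. 5.11; Cor. 6.6 of the 2004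
  paper; Corvino–Schoen 2006, Thm. 2 — the weighted-space local surjectivity of the constraint map
  and the extension by zero): for smooth coordinate data `(G, K)` on an open `T ⊇ closedBall z₀ ρ`
  of `E3`, `G` Riemannian, solving the coordinate vacuum constraints `hamAt G K = 0`,
  `momFn G K = 0` on `T`, without KIDs on `ball z₀ ρ`, and `k` smooth symmetric pairs
  `(γ_j, κ_j)` supported in a compact subset of the ball with `DΦ_{(G,K)}(γ_j, κ_j) = 0`
  (`linHamFn`, `linMomFn`), there are `r > 0` and families `(G_c, K_c)`, `c ∈ ball 0 r ⊆ ℝᵏ`,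
  jointly `C^∞` on `ball × T`, through `(G, K)` at `c = 0`, equal to `(G, K)` off the closed
  ball, symmetric, solving the coordinate vacuum constraints on `T`, with
  `∂_{c_j}|₀ (G_c, K_c) = (γ_j, κ_j)` on `T`.

The proof: choose `ρ ≤ ρ₀` with `Φ(B̄) ⊆ V` (`exists_chart_closedBall_subset`) and
`U = Φ(ball)`; the readings of `Φ^* D` are smooth Riemannian coordinate-vacuum data on the target
(`coordVacuum_comap_chart`); the witnessed tangents read in the chart are kernel pairs supported
in `c(K) ⊆ ball` (`exists_chartWitness`); `(M)` excludes KIDs, `(A)` produces `(G_c, K_c)`,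
`exists_localFamily_of_coordFamily` reassembles them into vacuum data on `X` equal to `D` off
`Φ(B̄) ⊆ V`, whose tangents are `c^* γ_j = a_j`, `c^* κ_j = b_j`
(`deriv_section_eq_pullbackBilin`); `ChruscielDelay_localConstraintDeformation_of_localFamily`
concludes.

## References

* P. T. Chruściel, E. Delay, Mém. Soc. Math. Fr. 94 (2003), Thm. 5.9, Prop. 5.10, Cor. 5.11.
  [ChruscielDelay2003]
* P. T. Chruściel, E. Delay, J. Geom. Phys. 51 (2004), §2 and Cor. 6.6. [ChruscielDelay2004]
* J. Corvino, R. Schoen, J. Differential Geom. 73 (2006), Thm. 2. [CorvinoSchoen2006]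
* V. Moncrief, J. Math. Phys. 16 (1975), 493–498. [Moncrief1975]
-/

noncomputable section

set_option maxSynthPendingDepth 3

open Bundle Set Function Filter TopologicalSpace Manifold Module Metric
open scoped Manifold ContDiff Topology

namespace Literature.Geometry.Lorentzian

/-- **`ChruscielDelay_localConstraintDeformation` from its two coordinate cores** `(M)` (no local
Killing fields ⇒ no coordinate KIDs on small chart balls; Moncrief 1975) and `(A)` (coordinate
vacuum data without KIDs on a ball admit compactly supported vacuum deformation families with
prescribed kernel tangents; Chruściel–Delay 2003, Thm. 5.9 / Prop. 5.10 / Cor. 5.11) — see the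
module docstring; `b₀` is any basis of `E3` (the coordinate constraint operators are written in
a basis). [cite: ChruscielDelay2003, Thm. 5.9, Prop. 5.10 and Cor. 5.11] -/
theorem ChruscielDelay_localConstraintDeformation_of_coordCore {ι : Type} [Fintype ι]
    (b₀ : Basis ι ℝ E3)
    (hM : ∀ (X : Type) [TopologicalSpace X] [ChartedSpace E3 X] [IsManifold (𝓡 3) ∞ X]
      [T2Space X] [SecondCountableTopology X] [ConnectedSpace X]
      (D : InitialDataSet (𝓡 3) X) (𝒟 : VacuumCauchyDevelopment D) (x₀ : X),
      (∀ [D.metric.HasLeviCivita], D.IsVacuumConstraintSolution) →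
      (haveI : 𝒟.metric.toPseudoRiemannianMetric.HasLeviCivita := 𝒟.metric.hasLeviCivita
        ∀ V : Set X, IsOpen V → IsConnected V → x₀ ∈ V →
          ∀ W : Set 𝒟.carrier, IsOpen W → 𝒟.embed '' V ⊆ W →
            ∀ ξ : (p : 𝒟.carrier) → TangentSpace (𝓡 4) p,
              ContMDiffOn (𝓡 4) ((𝓡 4).prod 𝓘(ℝ, E4)) ∞
                (fun p ↦ (Bundle.TotalSpace.mk' E4 p (ξ p) : TangentBundle (𝓡 4) 𝒟.carrier)) W →
              (∀ p ∈ W, ∀ Y₀ Z₀ : TangentSpace (𝓡 4) p,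
                𝒟.metric.val p (𝒟.metric.toPseudoRiemannianMetric.leviCivita ξ p Y₀) Z₀ +
                  𝒟.metric.val p Y₀ (𝒟.metric.toPseudoRiemannianMetric.leviCivita ξ p Z₀) = 0) →
              ∀ x ∈ V, ξ (𝒟.embed x) = 0) →
      ∃ ρ₀ : ℝ, 0 < ρ₀ ∧ closedBall (chartAt E3 x₀ x₀) ρ₀ ⊆ (chartAt E3 x₀).target ∧
        ∀ ρ : ℝ, 0 < ρ → ρ ≤ ρ₀ →
          ∀ (N : E3 → ℝ) (Y : E3 → E3),
            ContDiffOn ℝ ∞ N (ball (chartAt E3 x₀ x₀) ρ) →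
            ContDiffOn ℝ ∞ Y (ball (chartAt E3 x₀ x₀) ρ) →
            (∀ z ∈ ball (chartAt E3 x₀ x₀) ρ,
              MetricCoord.adjHamG (D.comap _ (ChartInverse.contMDiff_symm x₀) (ChartInverse.injective_mfderiv_symm x₀)).coordHOn (D.comap _ (ChartInverse.contMDiff_symm x₀) (ChartInverse.injective_mfderiv_symm x₀)).coordKOn N z + MetricCoord.adjMomGS (D.comap _ (ChartInverse.contMDiff_symm x₀) (ChartInverse.injective_mfderiv_symm x₀)).coordHOn (D.comap _ (ChartInverse.contMDiff_symm x₀) (ChartInverse.injective_mfderiv_symm x₀)).coordKOn Y z = 0 ∧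
              MetricCoord.adjHamK (D.comap _ (ChartInverse.contMDiff_symm x₀) (ChartInverse.injective_mfderiv_symm x₀)).coordHOn (D.comap _ (ChartInverse.contMDiff_symm x₀) (ChartInverse.injective_mfderiv_symm x₀)).coordKOn N z + MetricCoord.adjMomKS (D.comap _ (ChartInverse.contMDiff_symm x₀) (ChartInverse.injective_mfderiv_symm x₀)).coordHOn Y z = 0) →
            ∀ z ∈ ball (chartAt E3 x₀ x₀) ρ, N z = 0 ∧ Y z = 0)
    (hA : ∀ (k : ℕ) (T : Set E3) (z₀ : E3) (ρ : ℝ), IsOpen T → 0 < ρ → closedBall z₀ ρ ⊆ T →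
      ∀ (G K : E3 → E3 →L[ℝ] E3 →L[ℝ] ℝ), MetricCoord.IsMetricOn G T →
        (∀ z ∈ T, ∀ v : E3, v ≠ 0 → 0 < G z v v) →
        ContDiffOn ℝ ∞ K T → (∀ z ∈ T, ∀ v w : E3, K z v w = K z w v) →
        (∀ z ∈ T, MetricCoord.hamAt G K z = 0 ∧ ∀ Z : E3, MetricCoord.momFn b₀ G K z Z = 0) →
        (∀ (N : E3 → ℝ) (Y : E3 → E3),
          ContDiffOn ℝ ∞ N (ball z₀ ρ) → ContDiffOn ℝ ∞ Y (ball z₀ ρ) →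
          (∀ z ∈ ball z₀ ρ,
            MetricCoord.adjHamG G K N z + MetricCoord.adjMomGS G K Y z = 0 ∧
            MetricCoord.adjHamK G K N z + MetricCoord.adjMomKS G Y z = 0) →
          ∀ z ∈ ball z₀ ρ, N z = 0 ∧ Y z = 0) →
        ∀ (γ κ : Fin k → E3 → E3 →L[ℝ] E3 →L[ℝ] ℝ),
          (∀ j, ContDiffOn ℝ ∞ (γ j) T ∧ ContDiffOn ℝ ∞ (κ j) T ∧
            (∀ z v w, γ j z v w = γ j z w v) ∧ (∀ z v w, κ j z v w = κ j z w v) ∧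
            (∃ Kc : Set E3, IsCompact Kc ∧ Kc ⊆ ball z₀ ρ ∧ ∀ z, z ∉ Kc → γ j z = 0 ∧ κ j z = 0) ∧
            ∀ z ∈ T, MetricCoord.linHamFn b₀ G K (γ j) (κ j) z = 0 ∧
              ∀ Z : E3, MetricCoord.linMomFn b₀ G K (γ j) (κ j) z Z = 0) →
          ∃ (r : ℝ) (Gf Kf : EuclideanSpace ℝ (Fin k) → E3 → E3 →L[ℝ] E3 →L[ℝ] ℝ), 0 < r ∧
            ContDiffOn ℝ ∞ (fun q : EuclideanSpace ℝ (Fin k) × E3 ↦ Gf q.1 q.2) (ball 0 r ×ˢ T) ∧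
            ContDiffOn ℝ ∞ (fun q : EuclideanSpace ℝ (Fin k) × E3 ↦ Kf q.1 q.2) (ball 0 r ×ˢ T) ∧
            (∀ z ∈ T, Gf 0 z = G z ∧ Kf 0 z = K z) ∧
            (∀ c ∈ ball (0 : EuclideanSpace ℝ (Fin k)) r, ∀ z ∈ T, z ∉ closedBall z₀ ρ →
              Gf c z = G z ∧ Kf c z = K z) ∧
            (∀ c ∈ ball (0 : EuclideanSpace ℝ (Fin k)) r, ∀ z ∈ T, ∀ v w : E3,
              Gf c z v w = Gf c z w v ∧ Kf c z v w = Kf c z w v) ∧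
            (∀ c ∈ ball (0 : EuclideanSpace ℝ (Fin k)) r, ∀ z ∈ T,
              MetricCoord.hamAt (Gf c) (Kf c) z = 0 ∧
                ∀ Z : E3, MetricCoord.momFn b₀ (Gf c) (Kf c) z Z = 0) ∧
            ∀ j, ∀ z ∈ T, deriv (fun s : ℝ ↦ Gf (EuclideanSpace.single j s) z) 0 = γ j z ∧
              deriv (fun s : ℝ ↦ Kf (EuclideanSpace.single j s) z) 0 = κ j z) :
    ChruscielDelay_localConstraintDeformation := by
  refine ChruscielDelay_localConstraintDeformation_of_localFamily ?_
  intro X _ _ _ _ _ _ D 𝒟 x₀ hvac hKID V hV hx₀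
  -- (M): no coordinate KIDs on small balls around `c x₀`
  obtain ⟨ρ₀, hρ₀, -, hnoKID⟩ := hM X D 𝒟 x₀ hvac hKID
  -- the ball: `closedBall (c x₀) ρ ⊆ target`, `Φ(B̄) ⊆ V`, `ρ ≤ ρ₀`
  obtain ⟨ρ, hρ, hρle, hρT, hρV⟩ := InitialDataSet.exists_chart_closedBall_subset x₀ hV hx₀ hρ₀
  have hBT : ball (chartAt E3 x₀ x₀) ρ ⊆ (chartAt E3 x₀).target := ball_subset_closedBall.trans hρT
  refine ⟨(chartAt E3 x₀).symm '' ball (chartAt E3 x₀ x₀) ρ,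
    (chartAt E3 x₀).isOpen_image_symm_of_subset_target isOpen_ball hBT,
    ⟨chartAt E3 x₀ x₀, mem_ball_self hρ, (chartAt E3 x₀).left_inv (mem_chart_source E3 x₀)⟩,
    ?_, ?_⟩
  · rintro _ ⟨z, hz, rfl⟩
    exact hρV ⟨z, ball_subset_closedBall hz, rfl⟩
  intro k a b K hK hKU hw
  -- the witnessed tangents, read in the chart
  choose γ κ hγs hκs hγsym hκsym hsupp hker hid h0 using
    fun j ↦ InitialDataSet.exists_chartWitness x₀ D K (a j) (b j) (hw j) b₀
  -- `K ⊆ source`, `c(K)` compact `⊆ ball`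
  have hKsrc : K ⊆ (chartAt E3 x₀).source := by
    intro p hp
    obtain ⟨z, hz, rfl⟩ := hKU hp
    exact (chartAt E3 x₀).map_target (hBT hz)
  have hKc : IsCompact (chartAt E3 x₀ '' K) :=
    hK.image_of_continuousOn ((chartAt E3 x₀).continuousOn.mono hKsrc)
  have hKcB : chartAt E3 x₀ '' K ⊆ ball (chartAt E3 x₀ x₀) ρ := by
    rintro _ ⟨p, hp, rfl⟩
    obtain ⟨z, hz, rfl⟩ := hKU hp
    rw [(chartAt E3 x₀).right_inv (hBT hz)]
    exact hz
  have hsupp' : ∀ j, ∀ z : E3, z ∉ chartAt E3 x₀ '' K → γ j z = 0 ∧ κ j z = 0 := fun j z hz ↦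
    hsupp j z fun hzT hmem ↦ hz ⟨_, hmem, (chartAt E3 x₀).right_inv hzT⟩
  -- the readings of `Φ^* D`: smooth Riemannian coordinate-vacuum data on the target
  have hmet : MetricCoord.IsMetricOn (D.comap _ (ChartInverse.contMDiff_symm x₀) (ChartInverse.injective_mfderiv_symm x₀)).coordHOn (chartAt E3 x₀).target :=
    InitialDataSet.isMetricOn_coordHOn _
  have hGpos : ∀ z ∈ (chartAt E3 x₀).target, ∀ v : E3, v ≠ 0 → 0 < (D.comap _ (ChartInverse.contMDiff_symm x₀) (ChartInverse.injective_mfderiv_symm x₀)).coordHOn z v v :=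
    fun z hz v hv ↦ InitialDataSet.coordHOn_pos _ hz v hv
  have hKsm : ContDiffOn ℝ ∞ (D.comap _ (ChartInverse.contMDiff_symm x₀) (ChartInverse.injective_mfderiv_symm x₀)).coordKOn (chartAt E3 x₀).target := InitialDataSet.contDiffOn_coordKOn' _
  have hKsy : ∀ z ∈ (chartAt E3 x₀).target, ∀ v w : E3, (D.comap _ (ChartInverse.contMDiff_symm x₀) (ChartInverse.injective_mfderiv_symm x₀)).coordKOn z v w = (D.comap _ (ChartInverse.contMDiff_symm x₀) (ChartInverse.injective_mfderiv_symm x₀)).coordKOn z w v :=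
    fun z _ v w ↦ InitialDataSet.coordKOn_symm _ z v w
  have hcv : ∀ z ∈ (chartAt E3 x₀).target, MetricCoord.hamAt (D.comap _ (ChartInverse.contMDiff_symm x₀) (ChartInverse.injective_mfderiv_symm x₀)).coordHOn (D.comap _ (ChartInverse.contMDiff_symm x₀) (ChartInverse.injective_mfderiv_symm x₀)).coordKOn z = 0 ∧
      ∀ Z : E3, MetricCoord.momFn b₀ (D.comap _ (ChartInverse.contMDiff_symm x₀) (ChartInverse.injective_mfderiv_symm x₀)).coordHOn (D.comap _ (ChartInverse.contMDiff_symm x₀) (ChartInverse.injective_mfderiv_symm x₀)).coordKOn z Z = 0 :=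
    fun z hz ↦ InitialDataSet.coordVacuum_comap_chart x₀ D hvac b₀ hz
  -- (A): the coordinate deformation family
  obtain ⟨r, Gf, Kf, hr, hGfs, hKfs, hGf0, hGfoff, hGfsym, hGfcv, hGftan⟩ :=
    hA k (chartAt E3 x₀).target (chartAt E3 x₀ x₀) ρ (chartAt E3 x₀).open_target hρ hρT (D.comap _ (ChartInverse.contMDiff_symm x₀) (ChartInverse.injective_mfderiv_symm x₀)).coordHOn (D.comap _ (ChartInverse.contMDiff_symm x₀) (ChartInverse.injective_mfderiv_symm x₀)).coordKOn
      hmet hGpos hKsm hKsy hcv (hnoKID ρ hρ hρle) γ κ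
      (fun j ↦ ⟨hγs j, hκs j, hγsym j, hκsym j, ⟨_, hKc, hKcB, hsupp' j⟩, hker j⟩)
  -- reassembly on `X`
  obtain ⟨r₁, G₀, hr₁, hr₁r, hhs, hks, hG00, hvac₀, hsupp₀, hsec⟩ :=
    InitialDataSet.exists_localFamily_of_coordFamily x₀ D hvac hρT hr Gf Kf hGfs hKfs hGf0 hGfoff
      hGfsym b₀ hGfcv
  have hCc : IsCompact ((chartAt E3 x₀).symm '' closedBall (chartAt E3 x₀ x₀) ρ) :=
    (isCompact_closedBall _ _).image_of_continuousOn ((chartAt E3 x₀).continuousOn_symm.mono hρT)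
  have hCsrc : (chartAt E3 x₀).symm '' closedBall (chartAt E3 x₀ x₀) ρ ⊆ (chartAt E3 x₀).source := by
    rintro _ ⟨z, hz, rfl⟩
    exact (chartAt E3 x₀).map_target (hρT hz)
  have hGfs₁ : ContDiffOn ℝ ∞ (fun q : EuclideanSpace ℝ (Fin k) × E3 ↦ Gf q.1 q.2)
      (ball 0 r₁ ×ˢ (chartAt E3 x₀).target) :=
    hGfs.mono (prod_mono (ball_subset_ball hr₁r) Subset.rfl)
  have hKfs₁ : ContDiffOn ℝ ∞ (fun q : EuclideanSpace ℝ (Fin k) × E3 ↦ Kf q.1 q.2)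
      (ball 0 r₁ ×ˢ (chartAt E3 x₀).target) :=
    hKfs.mono (prod_mono (ball_subset_ball hr₁r) Subset.rfl)
  refine ⟨r₁, G₀, hr₁, hhs, hks, hG00, hvac₀, ⟨_, hCc, hρV, fun c _ x hx ↦ hsupp₀ c x hx⟩,
    fun j ↦ ⟨?_, ?_⟩⟩
  · funext p
    by_cases hp : p ∈ (chartAt E3 x₀).source
    · exact (InitialDataSet.deriv_section_eq_pullbackBilin x₀ hr₁ (fun c x ↦ (G₀ c).h.inner x) Gf
        hGfs₁ (fun c hc p hp ↦ (hsec c hc p hp).1) j (fun z hz ↦ (hGftan j z hz).1) hp).trans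
        (hid j p hp).1
    · have hpK : p ∉ K := fun h ↦ hp (hKsrc h)
      have hpC : p ∉ (chartAt E3 x₀).symm '' closedBall (chartAt E3 x₀ x₀) ρ := fun h ↦ hp (hCsrc h)
      exact (InitialDataSet.deriv_section_eq_zero (fun c x ↦ (G₀ c).h.inner x) j
        (fun c ↦ by
          show (G₀ c).h.inner p = (G₀ 0).h.inner p
          rw [(hsupp₀ c p hpC).1, (hsupp₀ 0 p hpC).1])).trans (h0 j p hpK).1.symm
  · funext p
    by_cases hp : p ∈ (chartAt E3 x₀).source
    · exact (InitialDataSet.deriv_section_eq_pullbackBilin x₀ hr₁ (fun c x ↦ (G₀ c).k x) Kf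
        hKfs₁ (fun c hc p hp ↦ (hsec c hc p hp).2) j (fun z hz ↦ (hGftan j z hz).2) hp).trans
        (hid j p hp).2
    · have hpK : p ∉ K := fun h ↦ hp (hKsrc h)
      have hpC : p ∉ (chartAt E3 x₀).symm '' closedBall (chartAt E3 x₀ x₀) ρ := fun h ↦ hp (hCsrc h)
      exact (InitialDataSet.deriv_section_eq_zero (fun c x ↦ (G₀ c).k x) j
        (fun c ↦ by
          show (G₀ c).k p = (G₀ 0).k p
          rw [(hsupp₀ c p hpC).2, (hsupp₀ 0 p hpC).2])).trans (h0 j p hpK).2.symm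

end Literature.Geometry.Lorentzian

end
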